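import Summits.BirchSwinnertonDyer.Rank1Residual.F1Sign2.OddBranchFEAtTwoPrelim
import HarnessLib

/-!
# `OddBranchFEAtTwoFinite` — Part 2 of the odd-branch functional equation at `2` (cell `bsd-f1-sign2`, seat `-an`, g3): §4, the
finite-level functional equation of the ODD Mazur–Tate element `mazurTateElementOdd f 2 n` under
`s ↦ −s_N − s` (sign `−σ·e`, `e = ±1` the Teichmüller part of `N`). See Part 1
(`OddBranchFEAtTwoPrelim`) for the overview and references.

TURNKEY filing by the typer seat `bsd-f1-sign2-ty` (D-ty-6, part 2/6 of -an g3's kernel file `OddFE.lean`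
200de6ab6bb130d9, pre-split by the planner): `HOME/MEMO-an-data/g3/split/OddBranchFEAtTwoFinite.lean` sha16 c3d50429e69ba11c
(joint farm checks `JointA_parts1to4` 000c30d5de228c06 / `JointB_parts1to6` cbbe6a2064807d53: rc 0, 0 warnings, 0 sorries),
re-filed VERBATIM. PROOF-ONLY module (theorems; no definition, no named fact). REF2-PLACEMENT-v8 §0: the odd-branch
functional equation at 2 is IN PRINT (Sprung, ANT 11 (2017), Cor. 4.14 at (p, i) = (2, 1); Sprung arXiv:1211.1352 Thm 3.16 /
Cor 3.17) — formalised here, not new; beyond-print theorem: no for the FE itself (value corollaries: REF2 placing).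
-/

set_option autoImplicit false

noncomputable section

open scoped MatrixGroups ModularForm

open CongruenceSubgroup PowerSeries Filter Topology
  Literature.NumberTheory.EllipticCurves Literature.NumberTheory.EllipticCurves.ModularForms
  Literature.NumberTheory.EllipticCurves.Sprung2017 Literature.Barriers.BirchSwinnertonDyer

namespace Summit.BirchSwinnertonDyer.Rank1Residual.F1Sign2

/-! ## §4. The finite-level functional equation of the ODD Mazur–Tate element at `2` -/

section FiniteLevel

variable {N : ℕ} [NeZero N] (f : CuspForm (Gamma0 N) 2)

/-- The odd Mazur–Tate element at `2`, mapped to `ℚ₂⟦T⟧`, as the `Δ`-doubled single sum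
`Σ_s 2[5^s/2^{n+2}]⁻ (1+T)^s` (`mazurTateElementOdd_two_eq`). [cite: MazurTateTeitelbaum1986Invent, §I.13] -/
theorem coe_map_mazurTateElementOdd_two (n : ℕ) :
    ((((mazurTateElementOdd f 2 n).map (algebraMap ℚ ℚ_[2])) : Polynomial ℚ_[2]) : ℚ_[2]⟦X⟧) =
      ∑ s : ZMod (2 ^ n), PowerSeries.C (((2 * ratMinusSymbol f
          ((((cyclotomicGenerator 2 : ZMod (2 ^ (n + 2))) ^ s.val).val : ℚ) / (2 : ℚ) ^ (n + 2)) :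
            ℚ) : ℚ_[2])) * (1 + X : ℚ_[2]⟦X⟧) ^ s.val := by
  classical
  rw [mazurTateElementOdd_two_eq, Polynomial.map_sum, coe_polynomial_sum]
  refine Finset.sum_congr rfl fun s _ ↦ ?_
  rw [Polynomial.map_mul, Polynomial.map_pow, Polynomial.map_add, Polynomial.map_X,
    Polynomial.map_one, Polynomial.map_C, Polynomial.coe_mul, Polynomial.coe_pow,
    Polynomial.coe_add, Polynomial.coe_X, Polynomial.coe_one, Polynomial.coe_C, eq_ratCast,
    add_comm (X : ℚ_[2]⟦X⟧) 1]

/-- **The doubled minus symbols `2·[a/2^{n+2}]⁻_f` are `2`-adic integers** for `f` with real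
coefficients and `4 ∤ N` (`norm_ratMinusSymbol_two_le_two`: `‖[a/2^k]⁻‖₂ ≤ 2`).
[cite: MazurTateTeitelbaum1986Invent, §I.8] -/
theorem exists_padicInt_coe_eq_two_mul_ratMinusSymbol (hreal : ∀ n, (cuspCoeff f n).im = 0)
    (h4 : ¬ 4 ∣ N) (n : ℕ) (x : ZMod (2 ^ (n + 2))) :
    ∃ z : ℤ_[2], (z : ℚ_[2]) =
      ((2 * ratMinusSymbol f ((x.val : ℚ) / (2 : ℚ) ^ (n + 2)) : ℚ) : ℚ_[2]) := by
  set q : ℚ := ratMinusSymbol f ((x.val : ℚ) / (2 : ℚ) ^ (n + 2)) with hq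
  have hden : ((x.val : ℚ) / (2 : ℚ) ^ (n + 2)).den ∣ 2 ^ (n + 2) := by
    have h := Rat.den_dvd (x.val : ℤ) ((2 : ℤ) ^ (n + 2))
    rw [Rat.divInt_eq_div] at h
    push_cast at h
    exact_mod_cast h
  have hqn : ‖(q : ℚ_[2])‖ ≤ 2 := norm_ratMinusSymbol_two_le_two f hreal h4 hden
  have h2 : ‖(2 : ℚ_[2])‖ = (2 : ℝ)⁻¹ := by
    have h := Padic.norm_p (p := 2)
    simpa using h
  have hnorm : ‖((2 * q : ℚ) : ℚ_[2])‖ ≤ 1 := by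
    push_cast
    rw [norm_mul, h2]
    calc (2 : ℝ)⁻¹ * ‖(q : ℚ_[2])‖ ≤ (2 : ℝ)⁻¹ * 2 := by gcongr
      _ = 1 := by norm_num
  exact ⟨⟨_, hnorm⟩, rfl⟩

omit [NeZero N] in
/-- The `2`-adic roots of unity of order dividing `torsionOrder 2 = 2` are `±1`. [folklore] -/
theorem coe_rootsOfUnity_torsionOrder_two (ξ : rootsOfUnity (torsionOrder 2) ℤ_[2]) :
    ((ξ : ℤ_[2]ˣ) : ℤ_[2]) = 1 ∨ ((ξ : ℤ_[2]ˣ) : ℤ_[2]) = -1 := by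
  set x : ℤ_[2] := ((ξ : ℤ_[2]ˣ) : ℤ_[2]) with hx
  have hη2 : x * x = 1 := by
    have h : x ^ torsionOrder 2 = 1 := (mem_rootsOfUnity' (torsionOrder 2) (ξ : ℤ_[2]ˣ)).mp ξ.2
    rwa [torsionOrder_two, pow_two] at h
  exact mul_self_eq_one_iff.mp hη2

omit [NeZero N] in
/-- An integer `e` with `(e : ℤ₂) = η` for `η ∈ μ₂(ℤ₂)` is `±1`. [folklore] -/
theorem eq_one_or_eq_neg_one_of_coe_rootsOfUnity_eq {ηN : rootsOfUnity (torsionOrder 2) ℤ_[2]}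
    {e : ℤ} (he : ((ηN : ℤ_[2]ˣ) : ℤ_[2]) = e) : e = 1 ∨ e = -1 := by
  rcases coe_rootsOfUnity_torsionOrder_two ηN with h | h
  · left; exact_mod_cast he.symm.trans h
  · right; exact_mod_cast he.symm.trans h

omit [NeZero N] in
/-- **`η_N = χ₄(N)`**: if `η_N · 5^{c_n} = N` in `ℤ/2^{n+2}` for all `n` (`N = η_N 5^c` in `ℤ₂^×`,
`exists_teichmuller_exponent_natCast`), then `η_N ≡ N (mod 4)`, i.e. `η_N = χ₄(N) = χ₋₄(N)`.
[cite: MazurTateTeitelbaum1986Invent, §I.13 (p = 2: Δ = {±1}, γ = 5)] -/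
theorem coe_rootsOfUnity_eq_chi4 {N : ℕ} {ηN : rootsOfUnity (torsionOrder 2) ℤ_[2]} {c : ℤ_[2]}
    (hc : ∀ n : ℕ, PadicInt.toZModPow (n + cyclotomicExponent 2) ((ηN : ℤ_[2]ˣ) : ℤ_[2]) *
      (cyclotomicGenerator 2 : ZMod (2 ^ (n + cyclotomicExponent 2))) ^
        (PadicInt.toZModPow n c).val = (N : ZMod (2 ^ (n + cyclotomicExponent 2)))) :
    ((ηN : ℤ_[2]ˣ) : ℤ_[2]) = ((ZMod.χ₄ (N : ZMod 4) : ℤ) : ℤ_[2]) := by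
  haveI : NeZero (2 ^ 0) := ⟨pow_ne_zero _ two_ne_zero⟩
  have h0 : PadicInt.toZModPow (0 + 2) ((ηN : ℤ_[2]ˣ) : ℤ_[2]) *
      (cyclotomicGenerator 2 : ZMod (2 ^ (0 + 2))) ^ (PadicInt.toZModPow 0 c).val =
        (N : ZMod (2 ^ (0 + 2))) := hc 0
  have hval : (PadicInt.toZModPow 0 c).val = 0 :=
    Nat.lt_one_iff.mp (lt_of_lt_of_eq (ZMod.val_lt _) (pow_zero 2))
  rw [hval, pow_zero, mul_one] at h0
  rcases coe_rootsOfUnity_torsionOrder_two ηN with h1 | h1 <;> rw [h1] at h0 ⊢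
  · rw [map_one] at h0
    have hmod : 1 % 2 ^ (0 + 2) = N % 2 ^ (0 + 2) :=
      (ZMod.natCast_eq_natCast_iff' 1 N (2 ^ (0 + 2))).mp (by rw [Nat.cast_one]; exact h0)
    norm_num at hmod
    rw [ZMod.χ₄_nat_eq_if_mod_four, if_neg (by omega), if_pos hmod.symm, Int.cast_one]
  · rw [map_neg, map_one] at h0
    have hmod : (N + 1) % 2 ^ (0 + 2) = 0 % 2 ^ (0 + 2) :=
      (ZMod.natCast_eq_natCast_iff' (N + 1) 0 (2 ^ (0 + 2))).mp (by
        rw [Nat.cast_add, Nat.cast_one, Nat.cast_zero, ← h0, neg_add_cancel])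
    norm_num at hmod
    rw [ZMod.χ₄_nat_eq_if_mod_four, if_neg (by omega), if_neg (by omega), Int.cast_neg, Int.cast_one]

/-- **The finite-level functional equation of the ODD Mazur–Tate element at `2`, integral.**
Let `f ∈ S₂(Γ₀(N))` be rational (`coeffField f = ⊥`) of odd level with `f|w_N = −σ f` (`σ² = 1`),
`N = η_N · 5^c` `2`-adically (`c ∈ ℤ₂`), `η_N = e = ±1`, `c_n` the representative of `c mod 2ⁿ`. Then
`θ⁻_n(T^ι) − ε (1+T)^{c_n} θ⁻_n(T) ∈ ω_n Λ` in `ℚ₂⟦T⟧` with **`ε = −σ e`**. Proof: `θ⁻_n = Σ_s z_s (1+T)^s`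
with `z_s = 2[5^s/2^{n+2}]⁻ ∈ ℤ₂`; along the involution `s ↦ −s_N − s` of `ℤ/2ⁿ`,
`N · 5^s · (−e 5^{−s_N−s}) = −1`, so the Fricke symmetry of the minus symbols and `[−x]⁻ = −[x]⁻`
give `z_s = ε z_{−s_N−s}`; then termwise `(1+T)^{−s} − (1+T)^{c_n + (−s_N−s)} ∈ ω_n Λ`.
[cite: MazurTateTeitelbaum1986Invent, §I.17 (functional equation, sign c_N ε̄ χ(−N)) and §I.8] -/
theorem exists_mazurTateElementOdd_fe (hQ : coeffField f = ⊥) (hN : ¬ 2 ∣ N) {σ : ℤ}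
    (hσ : σ ^ 2 = 1) (hW : IsFrickeEigen N f (-(σ : ℂ)))
    {ηN : rootsOfUnity (torsionOrder 2) ℤ_[2]} {c : ℤ_[2]}
    (hc : ∀ n : ℕ, PadicInt.toZModPow (n + cyclotomicExponent 2) ((ηN : ℤ_[2]ˣ) : ℤ_[2]) *
      (cyclotomicGenerator 2 : ZMod (2 ^ (n + cyclotomicExponent 2))) ^
        (PadicInt.toZModPow n c).val = (N : ZMod (2 ^ (n + cyclotomicExponent 2))))
    {e : ℤ} (he : ((ηN : ℤ_[2]ˣ) : ℤ_[2]) = e) (n : ℕ) :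
    ∃ r : IwasawaAlgebra 2,
      ((((mazurTateElementOdd f 2 n).map (algebraMap ℚ ℚ_[2]) : Polynomial ℚ_[2]) :
            ℚ_[2]⟦X⟧).subst (invOnePlusSubOne : ℚ_[2]⟦X⟧) -
          PowerSeries.C ((-(σ * e) : ℤ) : ℚ_[2]) * (1 + X : ℚ_[2]⟦X⟧) ^ (PadicInt.toZModPow n c).val *
            (((mazurTateElementOdd f 2 n).map (algebraMap ℚ ℚ_[2]) : Polynomial ℚ_[2]) :
              ℚ_[2]⟦X⟧)) =
        iwasawaToPowerSeries 2 (((cyclotomicOmega 2 n).map (Int.castRingHom ℤ_[2]) :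
          PowerSeries ℤ_[2])) * iwasawaToPowerSeries 2 r := by
  classical
  haveI : NeZero (2 ^ n) := ⟨pow_ne_zero _ two_ne_zero⟩
  haveI : NeZero (2 ^ (n + 2)) := ⟨pow_ne_zero _ two_ne_zero⟩
  have hιΛ := hasSubst_invOnePlusSubOne (R := ℤ_[2])
  have hreal : ∀ m, (cuspCoeff f m).im = 0 := cuspCoeff_im_eq_zero_of_coeffField_eq_bot hQ
  have h4 : ¬ 4 ∣ N := fun h ↦ hN (dvd_trans (by norm_num) h)
  have he1 : e = 1 ∨ e = -1 := eq_one_or_eq_neg_one_of_coe_rootsOfUnity_eq he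
  -- the sign
  set ε : ℤ := -(σ * e) with hε
  have hε2 : ε ^ 2 = 1 := by
    rcases he1 with h | h <;> rw [hε, h] <;> linear_combination hσ
  -- notation
  set sN : ZMod (2 ^ n) := PadicInt.toZModPow n c with hsN
  set γ : ZMod (2 ^ (n + 2)) := (cyclotomicGenerator 2 : ZMod (2 ^ (n + 2))) with hγ
  set P : IwasawaAlgebra 2 := (1 + X : ℤ_[2]⟦X⟧) with hP
  set E : IwasawaAlgebra 2 := (invOnePlusSubOne : ℤ_[2]⟦X⟧) + 1 with hE
  -- `N = e · γ^{s_N}` at level `2^{n+2}`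
  have hcn : (e : ZMod (2 ^ (n + 2))) * γ ^ sN.val = (N : ZMod (2 ^ (n + 2))) := by
    have h : PadicInt.toZModPow (n + 2) ((ηN : ℤ_[2]ˣ) : ℤ_[2]) *
        (cyclotomicGenerator 2 : ZMod (2 ^ (n + 2))) ^ (PadicInt.toZModPow n c).val =
          (N : ZMod (2 ^ (n + 2))) := hc n
    rw [he, map_intCast] at h
    exact h
  -- `γ` has order `2ⁿ`: exponents add modulo `2ⁿ`
  have hγord : orderOf γ = 2 ^ n := orderOf_cyclotomicGenerator 2 n
  have hγpow : ∀ a b : ZMod (2 ^ n), γ ^ (a + b).val = γ ^ a.val * γ ^ b.val := by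
    intro a b
    have h := pow_mod_orderOf γ (a.val + b.val)
    rw [hγord] at h
    rw [ZMod.val_add, h, pow_add γ]
  -- the integral coefficients `z_s = 2[γ^s/2^{n+2}]⁻`
  have hz : ∀ s : ZMod (2 ^ n), ∃ z : ℤ_[2], (z : ℚ_[2]) =
      ((2 * ratMinusSymbol f (((γ ^ s.val).val : ℚ) / (2 : ℚ) ^ (n + 2)) : ℚ) : ℚ_[2]) :=
    fun s ↦ exists_padicInt_coe_eq_two_mul_ratMinusSymbol f hreal h4 n (γ ^ s.val)
  choose z hz using hz
  -- their Fricke symmetry along the involution `s ↦ -s_N - s`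
  have hzsym : ∀ s : ZMod (2 ^ n), z s = (ε : ℤ_[2]) * z (-sN - s) := by
    intro s
    -- `N · γ^s · (−e γ^{−s_N−s}) = −1`
    have hprod : (N : ZMod (2 ^ (n + 2))) * γ ^ s.val *
        (-(e : ZMod (2 ^ (n + 2))) * γ ^ (-sN - s).val) = -1 := by
      have h1 : γ ^ sN.val * γ ^ s.val * γ ^ (-sN - s).val = 1 := by
        rw [← hγpow, ← hγpow, show sN + s + (-sN - s) = 0 by ring, ZMod.val_zero, pow_zero]
      have he2 : (e : ZMod (2 ^ (n + 2))) * (e : ZMod (2 ^ (n + 2))) = 1 := by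
        rcases he1 with h | h <;> simp [h]
      rw [← hcn]
      linear_combination (-((e : ZMod (2 ^ (n + 2))) * (e : ZMod (2 ^ (n + 2))))) * h1 - he2
    -- an integer relation `A · 2^{n+2} − u · (N u') = 1`
    have hdvd : ((2 ^ (n + 2) : ℕ) : ℤ) ∣ (N : ℤ) * (γ ^ s.val).val *
        ((-(e : ZMod (2 ^ (n + 2))) * γ ^ (-sN - s).val).val : ℤ) + 1 := by
      rw [← ZMod.intCast_zmod_eq_zero_iff_dvd]
      push_cast
      rw [ZMod.natCast_zmod_val, ZMod.natCast_zmod_val, hprod, neg_add_cancel]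
    obtain ⟨A, hA⟩ := hdvd
    have hrel : A * ((2 ^ (n + 2) : ℕ) : ℤ) - ((γ ^ s.val).val : ℤ) *
        (N * ((-(e : ZMod (2 ^ (n + 2))) * γ ^ (-sN - s).val).val : ℤ)) = 1 := by
      linear_combination -hA
    have k1 := ratMinusSymbol_div_eq_mul_of_isFrickeEigen' f hW hσ (pow_pos two_pos _) hrel
    push_cast at k1
    -- `[u'/2^{n+2}]⁻ = −e [γ^{−s_N−s}/2^{n+2}]⁻`
    have k2 : ratMinusSymbol f ((((-(e : ZMod (2 ^ (n + 2))) * γ ^ (-sN - s).val).val : ℚ)) /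
        (2 : ℚ) ^ (n + 2)) = -e * ratMinusSymbol f (((γ ^ (-sN - s).val).val : ℚ) /
          (2 : ℚ) ^ (n + 2)) := by
      have hneg := ratMinusSymbol_neg_val_div f (n + 2) (γ ^ (-sN - s).val)
      push_cast at hneg
      rcases he1 with h | h
      · have hu1 : -(e : ZMod (2 ^ (n + 2))) * γ ^ (-sN - s).val = -(γ ^ (-sN - s).val) := by
          rw [h]; push_cast; ring
        rw [hu1, hneg, h]; push_cast; ring
      · have hu1 : -(e : ZMod (2 ^ (n + 2))) * γ ^ (-sN - s).val = γ ^ (-sN - s).val := by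
          rw [h]; push_cast; ring
        rw [hu1, h]; push_cast; ring
    apply PadicInt.ext
    rw [PadicInt.coe_mul, hz s, hz (-sN - s)]
    push_cast
    rw [k1, k2, hε]
    push_cast
    ring
  -- the integral sum `Θ` and its image `θ⁻_n`
  set Θ : IwasawaAlgebra 2 := ∑ s : ZMod (2 ^ n), PowerSeries.C (z s) * P ^ s.val with hΘ
  have hΘK : iwasawaToPowerSeries 2 Θ =
      ((((mazurTateElementOdd f 2 n).map (algebraMap ℚ ℚ_[2])) : Polynomial ℚ_[2]) : ℚ_[2]⟦X⟧) := by
    rw [coe_map_mazurTateElementOdd_two, hΘ, map_sum]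
    refine Finset.sum_congr rfl fun s _ ↦ ?_
    rw [map_mul, map_pow, hP, map_add, map_one, PowerSeries.map_X, PowerSeries.map_C,
      PadicInt.algebraMap_apply, hz]
  -- `ε² = 1` in `Λ`
  have hεΛ : (ε : IwasawaAlgebra 2) * (ε : IwasawaAlgebra 2) = 1 := by
    have h := congrArg (Int.cast : ℤ → IwasawaAlgebra 2) hε2
    push_cast at h
    rw [← sq]; exact h
  -- reindexing along the involution `s ↦ -s_N - s`
  have hre : Θ = (ε : IwasawaAlgebra 2) *
      ∑ s : ZMod (2 ^ n), PowerSeries.C (z s) * P ^ (-sN - s).val := by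
    rw [hΘ, Finset.mul_sum, (Fintype.sum_equiv (Equiv.subLeft (-sN))
      (fun s ↦ PowerSeries.C (z (-sN - s)) * P ^ (-sN - s).val)
      (fun s ↦ PowerSeries.C (z s) * P ^ s.val) (fun _ ↦ rfl)).symm]
    refine Finset.sum_congr rfl fun s _ ↦ ?_
    have h := hzsym (-sN - s)
    rw [sub_sub_cancel] at h
    rw [h, map_mul, map_intCast]
    ring
  -- `Θ(T^ι)`
  have hSΘ : Θ.subst (invOnePlusSubOne : ℤ_[2]⟦X⟧) =
      ∑ s : ZMod (2 ^ n), PowerSeries.C (z s) * E ^ s.val := by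
    rw [hΘ, ← coe_substAlgHom hιΛ, map_sum]
    refine Finset.sum_congr rfl fun s _ ↦ ?_
    rw [map_mul, map_pow, C_eq_algebraMap, AlgHom.commutes, coe_substAlgHom hιΛ, hP,
      subst_invOnePlusSubOne_one_add_X, ← hE]
  -- the exponents `(-sN - s).val + sN.val + s.val` are multiples of `2ⁿ`
  have hdiv : ∀ s : ZMod (2 ^ n), 2 ^ n ∣ (-sN - s).val + sN.val + s.val := by
    intro s
    rw [← ZMod.natCast_eq_zero_iff]
    push_cast
    rw [ZMod.natCast_zmod_val, ZMod.natCast_zmod_val, ZMod.natCast_zmod_val]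
    ring
  choose k hk using hdiv
  -- termwise identity
  have hterm : ∀ (zz : ℤ_[2]) (s : ZMod (2 ^ n)),
      PowerSeries.C zz * E ^ s.val - P ^ sN.val * (PowerSeries.C zz * P ^ (-sN - s).val) =
        (P ^ 2 ^ n - 1) * -(PowerSeries.C zz * E ^ s.val *
          ∑ i ∈ Finset.range (k s), (P ^ 2 ^ n) ^ i) := by
    intro zz s
    have e1 := geom_sum_mul (P ^ 2 ^ n) (k s)
    have e2 : P ^ (-sN - s).val * P ^ sN.val * P ^ s.val = (P ^ 2 ^ n) ^ (k s) := by
      rw [← pow_add, ← pow_add, hk s, pow_mul]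
    have e3 : P ^ s.val * E ^ s.val = 1 := one_add_X_pow_mul_E_pow s.val
    linear_combination (PowerSeries.C zz * E ^ s.val) * e1 -
      (PowerSeries.C zz * E ^ s.val) * e2 + (PowerSeries.C zz * P ^ (-sN - s).val * P ^ sN.val) * e3
  -- the identity in `Λ`
  set r : IwasawaAlgebra 2 := ∑ s : ZMod (2 ^ n),
    -(PowerSeries.C (z s) * E ^ s.val * ∑ i ∈ Finset.range (k s), (P ^ 2 ^ n) ^ i) with hr
  have hΛ : Θ.subst (invOnePlusSubOne : ℤ_[2]⟦X⟧) - (ε : IwasawaAlgebra 2) * P ^ sN.val * Θ =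
      (((cyclotomicOmega 2 n).map (Int.castRingHom ℤ_[2]) : Polynomial ℤ_[2]) : ℤ_[2]⟦X⟧) * r := by
    rw [hSΘ, coe_map_cyclotomicOmega, ← hP]
    conv_lhs => rw [hre]
    set S2 := ∑ s : ZMod (2 ^ n), PowerSeries.C (z s) * P ^ (-sN - s).val with hS2
    have hεε : (ε : IwasawaAlgebra 2) * P ^ sN.val * ((ε : IwasawaAlgebra 2) * S2) =
        P ^ sN.val * S2 := by
      linear_combination (P ^ sN.val * S2) * hεΛ
    rw [hεε, hS2, hr, Finset.mul_sum, Finset.mul_sum, ← Finset.sum_sub_distrib]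
    refine Finset.sum_congr rfl fun s _ ↦ ?_
    exact hterm _ s
  -- map to `ℚ₂⟦T⟧`
  refine ⟨r, ?_⟩
  have hK := congrArg (iwasawaToPowerSeries 2) hΛ
  rw [map_sub, map_mul, map_mul, map_mul, map_pow, map_intCast,
    iwasawaToPowerSeries_subst_invOnePlusSubOne, hΘK, hP, map_add, map_one, PowerSeries.map_X] at hK
  rw [C_eq_algebraMap, map_intCast]
  linear_combination hK

/-- **The finite-level functional equation of `θ⁻_n`, doubled** (the shape consumed by the transport
argument, identical to the even file's `exists_two_mul_mazurTateElement_fe` with `θ_n ↦ θ⁻_n`,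
`σ ↦ ε = −σ η_N`): `2·(θ⁻_n(T^ι) − ε (1+T)^{c_n} θ⁻_n(T)) ∈ ω_n Λ`.
[cite: MazurTateTeitelbaum1986Invent, §I.17] -/
theorem exists_two_mul_mazurTateElementOdd_fe (hQ : coeffField f = ⊥) (hN : ¬ 2 ∣ N) {σ : ℤ}
    (hσ : σ ^ 2 = 1) (hW : IsFrickeEigen N f (-(σ : ℂ)))
    {ηN : rootsOfUnity (torsionOrder 2) ℤ_[2]} {c : ℤ_[2]}
    (hc : ∀ n : ℕ, PadicInt.toZModPow (n + cyclotomicExponent 2) ((ηN : ℤ_[2]ˣ) : ℤ_[2]) *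
      (cyclotomicGenerator 2 : ZMod (2 ^ (n + cyclotomicExponent 2))) ^
        (PadicInt.toZModPow n c).val = (N : ZMod (2 ^ (n + cyclotomicExponent 2))))
    {e : ℤ} (he : ((ηN : ℤ_[2]ˣ) : ℤ_[2]) = e) (n : ℕ) :
    ∃ r : IwasawaAlgebra 2,
      PowerSeries.C (2 : ℚ_[2]) *
          ((((mazurTateElementOdd f 2 n).map (algebraMap ℚ ℚ_[2]) : Polynomial ℚ_[2]) :
              ℚ_[2]⟦X⟧).subst (invOnePlusSubOne : ℚ_[2]⟦X⟧) -
            PowerSeries.C ((-(σ * e) : ℤ) : ℚ_[2]) * (1 + X : ℚ_[2]⟦X⟧) ^ (PadicInt.toZModPow n c).val *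
              (((mazurTateElementOdd f 2 n).map (algebraMap ℚ ℚ_[2]) : Polynomial ℚ_[2]) :
                ℚ_[2]⟦X⟧)) =
        iwasawaToPowerSeries 2 (((cyclotomicOmega 2 n).map (Int.castRingHom ℤ_[2]) :
          PowerSeries ℤ_[2])) * iwasawaToPowerSeries 2 r := by
  obtain ⟨r, hr⟩ := exists_mazurTateElementOdd_fe f hQ hN hσ hW hc he n
  refine ⟨2 * r, ?_⟩
  rw [hr, map_mul]
  simp only [map_ofNat]
  ring

end FiniteLevel

end Summit.BirchSwinnertonDyer.Rank1Residual.F1Sign2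

end
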